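import Summits.Ventures.PercRepro.BlockSum

/-!
# PercRepro — the cycle matroid `M(K₄ ∖ e)` on `Fin 5` and its rank table (p9, gen 14; local draft)

`proofs/P9-S4-KBLOCKS-g14.md`: the block `K₄ ∖ e` of the window map. The five edges of `K₄ ∖ 23` on the vertices
`0, 1, 2, 3` are numbered `0 = 01, 1 = 02, 2 = 03, 3 = 12, 4 = 13`; the three circuits are the triangles `{01,02,12}`,
`{01,03,13}` and the four-cycle `{02,12,13,03}`. Independence = «contains no circuit», the rank `rk X` = the largest independent subset of `X`
(a `Finset.sup`), the matroid `K4e` is `IndepMatroid.ofFinset` with the augmentation axiom decided in the kernel, and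
`eRk_coe : K4e.eRk ↑X = rk X`. The profile table `(rk X, rk Xᶜ)` over the 64 edge subsets is
`(0,3)·1, (1,3)·5, (2,2)·4, (2,3)·8, (3,2)·8, (3,1)·5, (3,0)·1` (`sum_profile`), and `3 ≤ rk X + rk Xᶜ`
(`three_le_rk_add_rk_compl`). Nothing here is about any window of S4.
-/

namespace PercRepro.K4eLadder

open Finset

/-- The three circuits of `M(K₄ ∖ e)`: the triangles `{01,02,12}`, `{01,03,13}` and the four-cycle `{02,12,13,03}`. -/
def circuits : Finset (Finset (Fin 5)) := {{0, 1, 3}, {0, 2, 4}, {1, 2, 3, 4}}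

/-- An edge set is independent (a forest) iff it contains no circuit. -/
def indepF (I : Finset (Fin 5)) : Prop := ∀ C ∈ circuits, ¬ C ⊆ I

/-- `indepF` is decidable (a bounded check over the seven circuits); the kernel computes with it. -/
instance indepF_decidable : DecidablePred indepF := fun I => by unfold indepF; infer_instance

/-- The rank of an edge set: the largest size of an independent subset. -/
def rk (X : Finset (Fin 5)) : ℕ := (X.powerset.filter indepF).sup Finset.card

/-- The profile of an edge set: `(rk X, rk Xᶜ)`. -/
def profile (X : Finset (Fin 5)) : ℕ × ℕ := (rk X, rk Xᶜ)

/-- The empty edge set is a forest. -/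
theorem indepF_empty : indepF ∅ := by decide

/-- A subset of a forest is a forest. -/
theorem indepF_subset {I J : Finset (Fin 5)} (hJ : indepF J) (hIJ : I ⊆ J) : indepF I :=
  fun C hC hCI => hJ C hC (hCI.trans hIJ)

/-- The augmentation axiom for the forests of `K₄`, decided in the kernel over the `32 × 32` pairs of edge sets. -/
theorem indepF_aug : ∀ I J : Finset (Fin 5), indepF I → indepF J → I.card < J.card →
    ∃ e ∈ J, e ∉ I ∧ indepF (insert e I) := by
  decide +kernel

/-- `3 ≤ rk X + rk Xᶜ` for every edge set (every profile of `M(K₄)` has `k₁ + k₂ ≥ 3`). -/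
theorem three_le_rk_add_rk_compl : ∀ X : Finset (Fin 5), 3 ≤ rk X + rk Xᶜ := by
  decide +kernel

/-- The seven profiles of `M(K₄ ∖ e)`. -/
theorem image_profile : (univ : Finset (Finset (Fin 5))).image profile
    = {(0, 3), (1, 3), (2, 2), (2, 3), (3, 2), (3, 1), (3, 0)} := by
  decide +kernel

/-- The profile `(0, 3)` has multiplicity `1`. -/
theorem card_fibre_03 : #{X ∈ (univ : Finset (Finset (Fin 5))) | profile X = (0, 3)} = 1 := by decide +kernel
/-- The profile `(1, 3)` has multiplicity `5` (the single edges). -/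
theorem card_fibre_13 : #{X ∈ (univ : Finset (Finset (Fin 5))) | profile X = (1, 3)} = 5 := by decide +kernel
/-- The profile `(2, 2)` has multiplicity `4`. -/
theorem card_fibre_22 : #{X ∈ (univ : Finset (Finset (Fin 5))) | profile X = (2, 2)} = 4 := by decide +kernel
/-- The profile `(2, 3)` has multiplicity `8`. -/
theorem card_fibre_23 : #{X ∈ (univ : Finset (Finset (Fin 5))) | profile X = (2, 3)} = 8 := by decide +kernel
/-- The profile `(3, 2)` has multiplicity `8`. -/
theorem card_fibre_32 : #{X ∈ (univ : Finset (Finset (Fin 5))) | profile X = (3, 2)} = 8 := by decide +kernel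
/-- The profile `(3, 1)` has multiplicity `5` (the complements of the single edges). -/
theorem card_fibre_31 : #{X ∈ (univ : Finset (Finset (Fin 5))) | profile X = (3, 1)} = 5 := by decide +kernel
/-- The profile `(3, 0)` has multiplicity `1` (the full edge set). -/
theorem card_fibre_30 : #{X ∈ (univ : Finset (Finset (Fin 5))) | profile X = (3, 0)} = 1 := by decide +kernel

/-- **The profile table of `M(K₄ ∖ e)`**: any sum over the 32 edge subsets of a function of the profile
`(rk X, rk Xᶜ)` is `F(0,3) + 5·F(1,3) + 4·F(2,2) + 8·F(2,3) + 8·F(3,2) + 5·F(3,1) + F(3,0)`. -/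
theorem sum_profile (F : ℕ × ℕ → ℕ) :
    ∑ X : Finset (Fin 5), F (profile X)
      = F (0, 3) + 5 * F (1, 3) + 4 * F (2, 2) + 8 * F (2, 3) + 8 * F (3, 2) + 5 * F (3, 1) + F (3, 0) := by
  rw [Finset.sum_comp, image_profile]
  rw [Finset.sum_insert (by decide), Finset.sum_insert (by decide), Finset.sum_insert (by decide),
    Finset.sum_insert (by decide), Finset.sum_insert (by decide), Finset.sum_insert (by decide),
    Finset.sum_singleton, card_fibre_03, card_fibre_13, card_fibre_22, card_fibre_23, card_fibre_32, card_fibre_31,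
    card_fibre_30]
  simp only [smul_eq_mul, one_mul]
  ring

/-! ### The matroid -/

/-- **The cycle matroid `M(K₄ ∖ e)`** on `Fin 5`, from the independence axioms of the forests. -/
def K4e : Matroid (Fin 5) :=
  (IndepMatroid.ofFinset (E := (Set.univ : Set (Fin 5))) indepF indepF_empty
    (fun _ _ hJ hIJ => indepF_subset hJ hIJ) (fun _ _ hI hJ h => indepF_aug _ _ hI hJ h)
    (fun _ _ => Set.subset_univ _)).matroid

/-- The ground set of `K4e` is `Fin 5`. -/
theorem K4e_ground : K4e.E = Set.univ := rfl

/-- `M(K₄ ∖ e)` is a finite matroid. -/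
theorem K4e_finite : K4e.Finite := ⟨Set.finite_univ⟩

/-- Independence in `K4e` is `indepF`. -/
theorem K4e_indep_iff (I : Finset (Fin 5)) : K4e.Indep ↑I ↔ indepF I := by
  rw [K4e, IndepMatroid.matroid_indep_iff, IndepMatroid.ofFinset_indep]

/-- **The rank function of `M(K₄ ∖ e)`** is `rk`. -/
theorem eRk_coe (X : Finset (Fin 5)) : K4e.eRk ↑X = (rk X : ℕ∞) := by
  apply le_antisymm
  · rw [Matroid.eRk_le_iff]
    intro I hIX hI
    obtain ⟨J, rfl⟩ := (Set.toFinite I).exists_finset_coe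
    rw [K4e_indep_iff] at hI
    rw [Set.encard_coe_eq_coe_finsetCard]
    exact_mod_cast Finset.le_sup (f := Finset.card)
      (Finset.mem_filter.2 ⟨Finset.mem_powerset.2 (Finset.coe_subset.1 hIX), hI⟩)
  · rw [Matroid.le_eRk_iff]
    obtain ⟨J, hJ, hJsup⟩ := Finset.exists_mem_eq_sup (X.powerset.filter indepF)
      ⟨∅, Finset.mem_filter.2 ⟨Finset.mem_powerset.2 (Finset.empty_subset X), indepF_empty⟩⟩ Finset.card
    rw [Finset.mem_filter, Finset.mem_powerset] at hJ
    exact ⟨↑J, Finset.coe_subset.2 hJ.1, (K4e_indep_iff J).2 hJ.2,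
      by rw [Set.encard_coe_eq_coe_finsetCard, rk, hJsup]⟩

/-- The rank of the complement of an edge set. -/
theorem eRk_compl_coe (X : Finset (Fin 5)) : K4e.eRk (K4e.E \ ↑X) = (rk Xᶜ : ℕ∞) := by
  rw [K4e_ground, ← Set.compl_eq_univ_sdiff, ← Finset.coe_compl, eRk_coe]

end PercRepro.K4eLadder
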